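import Summits.CriticalPhenomena.PercolationContinuityZ3.Theorems.PercNearOneGluingNoHeavyLowerTailSahiAllButOneCylinders

/-!
# `NoHeavyLowerTail` (crux stmt-CriticalPhenomena-4575), Sahi / Kahn positivity: the ALL-BUT-ONE slot (III) — the certificate and the theorem

Support file (cell `prim-l12`, seat P3, gen 8; `--supports stmt-CriticalPhenomena-4575`).  No `sorry`, no named facts, standard axioms.
New mathematics (this programme).

**THEOREM (Kahn's Conjecture 5 / Sahi's `C₃` for the ALL-BUT-ONE first slot).**  Let `e : Fin k ↪ ι` (`k ≥ 1`) be a block of a finite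
product space with parameters in `(0,1)` on the block and `H = {ω : at most one coordinate of the block is closed}` (the threshold event
`Th_{k−1}^k`; `k = 3` is majority; for `k ≥ 5` these events are neither read-once nor juntas on `≤ 4` coordinates nor cascades).  Then
`E₃(1_H, 1_U, 1_V) ≥ 0` for ALL increasing `U, V`, in every dimension (`sahiE_three_nonneg_of_allButOne`,
`sahiE_three_allButOneEvent_nonneg`).  PROOF: `ρ = μ(· | exactly one coordinate closed)` is a reduced transport certificate
(`rhoCert_allButOne`): (a) and (o) by `…SahiAllButOneCylinders.a_ineq'`/`o_ineq'`, (TC) by the trace reduction to cylinder pairs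
(monotonicity of the right-hand side in `w(𝒳), w(𝒵)` via two Harris inequalities) and the four-region polynomial inequality
`…SahiAllButOneCylinders.tc_ineq` / `…SahiAllButOnePoly.allButOne_cylPair_poly`.  Numerically (seat gen 8) the same recipe
`ρ = μ(· | exactly t blocks full)` certifies every threshold-of-disjoint-cylinders event through `k = 7`. [this work]
-/

noncomputable section

open scoped Classical

namespace Summit.CriticalPhenomena.PercolationContinuityZ3.Theorems

namespace SahiAllButOne

open Finset
open SahiHittingSlot SahiTransportCert
open Literature.Combinatorics.Sahi2008
open Literature.Probability.Percolation (DeterminedBy determinedBy_iff)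
open Literature.Probability.Percolation.BHK2006 (weight ind_inter)
open Literature.Probability.Percolation.DecisionTree (ind ind_of_mem ind_of_not_mem ind_nonneg)

variable {k : ℕ} (q : Fin k → unitInterval)

/-! ### Three real-variable inequalities -/

/-- The capacity inequality (a) in cleared form: `(1+σ)(Π−1−σ) ≤ (2Π−1−σ)σ` when `Π(1−σ) ≤ 1`. [this work] -/
theorem a_ineq (P σ : ℝ) (hσ : 0 ≤ σ) (h : P * (1 - σ) ≤ 1) : (1 + σ) * (P - 1 - σ) ≤ (2 * P - 1 - σ) * σ := by
  nlinarith [h, hσ]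

/-- The inequality (o) for a cylinder in cleared form (two regions `A`, `Aᶜ`). [this work] -/
theorem o_ineq (PA Pc sA sc : ℝ) (hsA : 0 ≤ sA) (hsc : 0 ≤ sc) (hPA : 1 ≤ PA) (hPc : 1 + sc ≤ Pc) (hA : PA * (1 - sA) ≤ 1) :
    (sA + sc) * (PA - 1 - sA) ≤ (PA * Pc - 1 - sA - sc) * sA := by
  have h1 : PA * (1 + sc) ≤ PA * Pc := mul_le_mul_of_nonneg_left hPc (by linarith)
  have h2 : 0 ≤ sc * (1 - PA * (1 - sA)) := mul_nonneg hsc (by linarith)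
  nlinarith [mul_le_mul_of_nonneg_right h1 hsA, h2]

/-- The capacity inequality (a) with the weight `W = 1/Π`. [this work] -/
theorem a_ineq' (W P σ : ℝ) (hσ : 0 ≤ σ) (hP : 0 < P) (h : P * (1 - σ) ≤ 1) (hW : W * P = 1) :
    W * (1 + σ) * (1 - W * (1 + σ)) ≤ (2 - W * (1 + σ)) * (W * σ) := by
  have ha := a_ineq P σ hσ h
  have hWeq : W = 1 / P := by rw [eq_div_iff hP.ne']; exact hW
  subst hWeq
  rw [← sub_nonneg]
  have hid : (2 - 1 / P * (1 + σ)) * (1 / P * σ) - 1 / P * (1 + σ) * (1 - 1 / P * (1 + σ)) =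
      ((2 * P - 1 - σ) * σ - (1 + σ) * (P - 1 - σ)) / P ^ 2 := by
    field_simp
    ring
  rw [hid]
  exact div_nonneg (by linarith) (pow_pos hP 2).le

/-- The inequality (o) for a cylinder with the weight `W = 1/(Π_A Π_{Aᶜ})`. [this work] -/
theorem o_ineq' (W PA Pc sA sc : ℝ) (hsA : 0 ≤ sA) (hsc : 0 ≤ sc) (hPA : 1 ≤ PA) (hPc : 1 + sc ≤ Pc) (hA : PA * (1 - sA) ≤ 1)
    (hσ : 0 < sA + sc) (hW : W * (PA * Pc) = 1) :
    W * PA - (W + W * sA) ≤ (1 - W * (1 + (sA + sc))) * (sA / (sA + sc)) := by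
  have ho := o_ineq PA Pc sA sc hsA hsc hPA hPc hA
  have hPA0 : PA ≠ 0 := ne_of_gt (by linarith)
  have hPc0 : Pc ≠ 0 := ne_of_gt (by linarith)
  have hPp : 0 < PA * Pc := mul_pos (by linarith) (by linarith)
  have hWeq : W = 1 / (PA * Pc) := by rw [eq_div_iff hPp.ne']; exact hW
  subst hWeq
  rw [← sub_nonneg]
  have hid : (1 - 1 / (PA * Pc) * (1 + (sA + sc))) * (sA / (sA + sc)) - (1 / (PA * Pc) * PA - (1 / (PA * Pc) + 1 / (PA * Pc) * sA)) =
      ((PA * Pc - 1 - sA - sc) * sA - (sA + sc) * (PA - 1 - sA)) / ((sA + sc) * (PA * Pc)) := by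
    field_simp
    ring
  rw [hid]
  exact div_nonneg (by linarith) (mul_pos hσ hPp).le

/-- The transport condition for a cylinder pair, from `allButOne_cylPair_poly` (division bookkeeping). [this work] -/
theorem tc_ineq (W P0 P1 P2 P3 s0 s1 s2 s3 : ℝ) (hs0 : 0 ≤ s0) (hs1 : 0 ≤ s1) (hs2 : 0 ≤ s2) (hs3 : 0 ≤ s3)
    (hP0 : 1 + s0 ≤ P0) (hP1 : 1 + s1 ≤ P1) (hP2 : 1 + s2 ≤ P2) (hP3 : 1 + s3 ≤ P3) (hσ : 0 < s0 + s1 + s2 + s3)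
    (hW : W * (P0 * P1 * P2 * P3) = 1) :
    W * (1 + (s0+s1+s2+s3)) * (1 - W * (1 + (s0+s1+s2+s3))) * (s3 / (s0+s1+s2+s3)) ≤
      (2 - W * (1 + (s0+s1+s2+s3))) * (W * (1 + s3)) + W * (1 + (s0+s1+s2+s3)) * (W * (P1 * P3)) * (W * (P2 * P3))
        - W * (P1 * P3) * (W * (1 + (s2 + s3))) - W * (P2 * P3) * (W * (1 + (s1 + s3))) := by
  have key := allButOne_cylPair_poly P0 P1 P2 P3 s0 s1 s2 s3 hs0 hs1 hs2 hs3 hP0 hP1 hP2 hP3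
  have hP0' : 0 < P0 := by linarith
  have hP1' : 0 < P1 := by linarith
  have hP2' : 0 < P2 := by linarith
  have hP3' : 0 < P3 := by linarith
  have hPi : 0 < P0 * P1 * P2 * P3 := by positivity
  have hWeq : W = 1 / (P0 * P1 * P2 * P3) := by rw [eq_div_iff hPi.ne']; exact hW
  subst hWeq
  have hσne : (s0 + s1 + s2 + s3) ≠ 0 := hσ.ne'
  rw [← sub_nonneg]
  have hid : (2 - 1 / (P0 * P1 * P2 * P3) * (1 + (s0+s1+s2+s3))) * (1 / (P0 * P1 * P2 * P3) * (1 + s3))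
      + 1 / (P0 * P1 * P2 * P3) * (1 + (s0+s1+s2+s3)) * (1 / (P0 * P1 * P2 * P3) * (P1 * P3)) * (1 / (P0 * P1 * P2 * P3) * (P2 * P3))
      - 1 / (P0 * P1 * P2 * P3) * (P1 * P3) * (1 / (P0 * P1 * P2 * P3) * (1 + (s2 + s3)))
      - 1 / (P0 * P1 * P2 * P3) * (P2 * P3) * (1 / (P0 * P1 * P2 * P3) * (1 + (s1 + s3)))
      - 1 / (P0 * P1 * P2 * P3) * (1 + (s0+s1+s2+s3)) * (1 - 1 / (P0 * P1 * P2 * P3) * (1 + (s0+s1+s2+s3))) * (s3 / (s0+s1+s2+s3))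
      = ((s0+s1+s2+s3) * P0 * (2 * (P0*P1*P2*P3) - 1 - (s0+s1+s2+s3)) * (1 + s3) + (s0+s1+s2+s3) * (1 + (s0+s1+s2+s3)) * P3
          - (s0+s1+s2+s3) * P0 * P3 * (P1 * (1 + s2 + s3) + P2 * (1 + s1 + s3))
          - P0 * (1 + (s0+s1+s2+s3)) * (P0*P1*P2*P3 - 1 - (s0+s1+s2+s3)) * s3)
        / ((s0+s1+s2+s3) * P0 * (P0 * P1 * P2 * P3) ^ 2) := by
    field_simp
    ring
  rw [hid]
  exact div_nonneg (by linarith) (by positivity)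

/-! ### The certificate -/

/-- `w(⊤∖i) ≥ 0`. [this work] -/
theorem wco_nonneg (i : Fin k) : 0 ≤ wco q i := bw_nonneg q _

/-- `ρ(⊤∖i) = w(⊤∖i)/π`. [this work] -/
theorem rho_cofin (i : Fin k) : rho q (cofin i) = wco q i / piOne q := by
  unfold rho
  rw [sum_eq_single i (fun j _ hji => if_neg fun h => hji (cofin_injective h).symm) (fun h => (h (mem_univ i)).elim), if_pos rfl]

section Cert

variable {q} (hq : ∀ i, 0 < (q i : ℝ) ∧ (q i : ℝ) < 1)
include hq

/-- `Σ_{i∈A} w(⊤∖i) = W·Σ_{i∈A} r_i`. [this work] -/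
theorem sum_wco (A : Finset (Fin k)) : ∑ i ∈ A, wco q i = W q * ∑ i ∈ A, r q i := by
  rw [mul_sum]; exact sum_congr rfl fun i _ => wco_eq_W_mul_r hq i

/-- `Σ_{i∈A} w(⊤∖i)/π = (Σ_{A} r)/(Σ r)` (nonempty block). [this work] -/
theorem sum_wco_div (A : Finset (Fin k)) : ∑ i ∈ A, wco q i / piOne q = (∑ i ∈ A, r q i) / ∑ i, r q i := by
  rw [← sum_div, sum_wco hq, piOne_eq hq, mul_div_mul_left _ _ (W_pos hq).ne']

/-- `1 + Σ_A r ≤ ∏_A (1 + r)`. [this work] -/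
theorem one_add_sum_le (A : Finset (Fin k)) : 1 + ∑ i ∈ A, r q i ≤ ∏ i ∈ A, (1 + r q i) :=
  one_add_sum_le_prod_one_add A _ fun i _ => r_nonneg hq i

set_option maxHeartbeats 4000000 in
/-- **THE ALL-BUT-ONE CERTIFICATE.**  For interior parameters, `ρ = μ(· | exactly one coordinate closed)` is a reduced transport
certificate of the pattern event `allButOne k`. [this work] -/
theorem rhoCert_allButOne (hk : 0 < k) : RhoCert q (allButOne k) (rho q) := by
  -- notation and basic positivity
  have hW := W_pos hq
  have hπ := piOne_pos hq hk
  have hr0 : ∀ i, 0 ≤ r q i := r_nonneg hq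
  have hσ : 0 < ∑ i, r q i := sum_pos (fun i _ => r_pos hq i) ⟨⟨0, hk⟩, mem_univ _⟩
  have hθ : pr q (allButOne k) = W q * (1 + ∑ i, r q i) := pr_allButOne_eq hq
  have hWP : W q * ∏ i, (1 + r q i) = 1 := W_mul_prod hq
  have hPσ : (∏ i, (1 + r q i)) * (1 - ∑ i, r q i) ≤ 1 := prod_one_add_mul_one_sub_sum_le_one univ _ fun i _ => hr0 i
  have hPpos : 0 < ∏ i, (1 + r q i) := prod_pos fun i _ => by linarith [hr0 i]
  refine ⟨fun T => ?_, fun T hT => ?_, ?_, fun T => ?_, fun 𝒯 h𝒯 => ?_, fun 𝒳 𝒵 h𝒳 h𝒵 => ?_⟩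
  · -- `ρ ≥ 0`
    exact sum_nonneg fun i _ => by split_ifs; exacts [div_nonneg (wco_nonneg q i) hπ.le, le_rfl]
  · -- `ρ = 0` off the event
    exact sum_eq_zero fun i _ => if_neg fun h : T = cofin i => hT (by rw [h]; exact cofin_mem_allButOne i)
  · -- total mass `1`
    have h := sum_rho_mul q fun _ => (1 : ℝ)
    simp only [mul_one] at h
    rw [h, ← sum_div]
    exact div_self hπ.ne'
  · -- (a) capacity
    by_cases hT : ∃ i, T = cofin i
    · obtain ⟨i, rfl⟩ := hT
      rw [rho_cofin q]
      have hcap : pr q (allButOne k) * (1 - pr q (allButOne k)) ≤ (2 - pr q (allButOne k)) * piOne q := by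
        rw [hθ, piOne_eq hq]
        exact a_ineq' (W q) (∏ i, (1 + r q i)) (∑ i, r q i) hσ.le hPpos hPσ hWP
      calc pr q (allButOne k) * (1 - pr q (allButOne k)) * (wco q i / piOne q)
          = pr q (allButOne k) * (1 - pr q (allButOne k)) / piOne q * wco q i := by ring
        _ ≤ (2 - pr q (allButOne k)) * wco q i := by
            refine mul_le_mul_of_nonneg_right ?_ (wco_nonneg q i)
            rw [div_le_iff₀ hπ]; exact hcap
        _ = (2 - pr q (allButOne k)) * bernoulliWeight q (cofin i) := rfl
    · have h0 : rho q T = 0 := sum_eq_zero fun i _ => if_neg fun h => hT ⟨i, h⟩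
      rw [h0, mul_zero]
      exact mul_nonneg (by linarith [pr_le_one q (allButOne k)]) (bw_nonneg q T)
  · -- (o) domination on up-sets
    by_cases hne : 𝒯.Nonempty
    · rw [pr_compl_inter, sum_rho_ind, sum_wco_div hq, pr_allButOne_inter_eq_live q h𝒯 hne, sum_wco hq, hθ]
      have hx : pr q 𝒯 ≤ W q * ∏ i ∈ live 𝒯, (1 + r q i) := by
        rw [← pr_cyl_compl hq]; exact pr_mono q (subset_cyl_of_isUpperSet h𝒯)
      -- two regions `A`, `Aᶜ`
      have hPsplit : ∏ i, (1 + r q i) = (∏ i ∈ live 𝒯, (1 + r q i)) * ∏ i ∈ (live 𝒯)ᶜ, (1 + r q i) := (prod_mul_prod_compl (live 𝒯) _).symm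
      have hσsplit : ∑ i, r q i = (∑ i ∈ live 𝒯, r q i) + ∑ i ∈ (live 𝒯)ᶜ, r q i := (sum_add_sum_compl (live 𝒯) _).symm
      have hPA1 : 1 ≤ ∏ i ∈ live 𝒯, (1 + r q i) := by
        have := one_add_sum_le hq (live 𝒯); linarith [sum_nonneg fun i (_ : i ∈ live 𝒯) => hr0 i]
      have hPAσ : (∏ i ∈ live 𝒯, (1 + r q i)) * (1 - ∑ i ∈ live 𝒯, r q i) ≤ 1 := prod_one_add_mul_one_sub_sum_le_one (live 𝒯) _ fun i _ => hr0 i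
      have hWA : W q * ((∏ i ∈ live 𝒯, (1 + r q i)) * ∏ i ∈ (live 𝒯)ᶜ, (1 + r q i)) = 1 := by rw [← hPsplit]; exact hWP
      have hσA : 0 < (∑ i ∈ live 𝒯, r q i) + ∑ i ∈ (live 𝒯)ᶜ, r q i := by rw [← hσsplit]; exact hσ
      have ho := o_ineq' (W q) (∏ i ∈ live 𝒯, (1 + r q i)) (∏ i ∈ (live 𝒯)ᶜ, (1 + r q i)) (∑ i ∈ live 𝒯, r q i) (∑ i ∈ (live 𝒯)ᶜ, r q i)
        (sum_nonneg fun i _ => hr0 i) (sum_nonneg fun i _ => hr0 i) hPA1 (one_add_sum_le hq (live 𝒯)ᶜ) hPAσ hσA hWA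
      rw [hσsplit]
      linarith [hx, ho]
    · rw [Set.not_nonempty_iff_eq_empty.1 hne, Set.inter_empty, SahiTransportCert.pr_empty]
      exact mul_nonneg (by linarith [pr_le_one q (allButOne k)]) (sum_nonneg fun T _ => by
        rw [ind_of_not_mem (Set.notMem_empty T), mul_zero])
  · -- (TC) on pairs of up-sets
    by_cases hne : 𝒳.Nonempty ∧ 𝒵.Nonempty
    · obtain ⟨hX, hZ⟩ := hne
      set A := live 𝒳 with hA
      set B := live 𝒵 with hB
      -- the quantities
      have hXZ : (𝒳 ∩ 𝒵).Nonempty := ⟨Set.univ, h𝒳 (Set.subset_univ _) hX.some_mem, h𝒵 (Set.subset_univ _) hZ.some_mem⟩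
      have hhX : pr q (allButOne k ∩ 𝒳) = W q + W q * ∑ i ∈ A, r q i := by rw [pr_allButOne_inter_eq_live q h𝒳 hX, sum_wco hq]
      have hhZ : pr q (allButOne k ∩ 𝒵) = W q + W q * ∑ i ∈ B, r q i := by rw [pr_allButOne_inter_eq_live q h𝒵 hZ, sum_wco hq]
      have hhXZ : pr q (allButOne k ∩ (𝒳 ∩ 𝒵)) = W q + W q * ∑ i ∈ A ∩ B, r q i := by
        rw [pr_allButOne_inter_eq_live q (h𝒳.inter h𝒵) hXZ, live_inter, sum_wco hq]
      have hLHS : ∑ T, rho q T * ind (𝒳 ∩ 𝒵) T = (∑ i ∈ A ∩ B, r q i) / ∑ i, r q i := by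
        rw [sum_rho_ind, live_inter, sum_wco_div hq]
      have hx : pr q 𝒳 ≤ W q * ∏ i ∈ A, (1 + r q i) := by
        rw [← pr_cyl_compl hq]; exact pr_mono q (subset_cyl_of_isUpperSet h𝒳)
      have hz : pr q 𝒵 ≤ W q * ∏ i ∈ B, (1 + r q i) := by
        rw [← pr_cyl_compl hq]; exact pr_mono q (subset_cyl_of_isUpperSet h𝒵)
      -- Harris: `w(H∩𝒳) ≥ θ w(𝒳)` and `w(H ∩ cyl) ≥ θ w(cyl)`
      have hHX : pr q (allButOne k) * pr q 𝒳 ≤ pr q (allButOne k ∩ 𝒳) := pr_mul_pr_le_pr_inter q isUpperSet_allButOne h𝒳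
      have hHZc : pr q (allButOne k) * (W q * ∏ i ∈ B, (1 + r q i)) ≤ W q + W q * ∑ i ∈ B, r q i := by
        have h := pr_mul_pr_le_pr_inter q isUpperSet_allButOne (isUpperSet_cyl (↑Bᶜ : Set (Fin k)))
        rw [pr_cyl_compl hq, pr_allButOne_inter_cyl, sum_wco hq] at h; exact h
      -- rewrite the right-hand side of (TC)
      have htc : tcRHS q (allButOne k) 𝒳 𝒵 =
          (2 - pr q (allButOne k)) * (pr q (allButOne k ∩ (𝒳 ∩ 𝒵)) - pr q 𝒳 * pr q 𝒵)
            + pr q 𝒳 * (pr q 𝒵 - pr q (allButOne k ∩ 𝒵)) + pr q 𝒵 * (pr q 𝒳 - pr q (allButOne k ∩ 𝒳)) := by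
        rw [tcRHS, pr_compl_inter, pr_compl_inter, pr_compl_inter]; ring
      rw [htc, hLHS, hhX, hhZ, hhXZ, hθ]
      rw [hθ] at hHX hHZc
      rw [hhX] at hHX
      -- Step 1: monotonicity in `w(𝒳)`, `w(𝒵)` (reduce to the cylinders)
      set x := pr q 𝒳 with hxdef
      set z := pr q 𝒵 with hzdef
      set xh := W q * ∏ i ∈ A, (1 + r q i) with hxh
      set zh := W q * ∏ i ∈ B, (1 + r q i) with hzh
      set θ := W q * (1 + ∑ i, r q i) with hθdef
      set hXv := W q + W q * ∑ i ∈ A, r q i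
      set hZv := W q + W q * ∑ i ∈ B, r q i
      set hXZv := W q + W q * ∑ i ∈ A ∩ B, r q i
      have hx0 : 0 ≤ x := pr_nonneg q 𝒳
      have hz0 : 0 ≤ z := pr_nonneg q 𝒵
      have step1 : (2 - θ) * (hXZv - xh * zh) + xh * (zh - hZv) + zh * (xh - hXv) ≤
          (2 - θ) * (hXZv - x * z) + x * (z - hZv) + z * (x - hXv) := by
        have e1 : 0 ≤ (xh - x) * (hZv - θ * zh) := mul_nonneg (by linarith) (by linarith)
        have e2 : 0 ≤ (zh - z) * (hXv - θ * x) := mul_nonneg (by linarith) (by linarith)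
        nlinarith [e1, e2]
      refine le_trans ?_ step1
      -- Step 2: the cylinder pair, four regions
      have hP4 := prod_four_regions A B fun i => 1 + r q i
      have hσ4 := sum_four_regions A B (r q)
      have hPA' := prod_split_left A B fun i => 1 + r q i
      have hPB' := prod_split_right A B fun i => 1 + r q i
      have hσA := sum_split_left A B (r q)
      have hσB := sum_split_right A B (r q)
      simp only [hxh, hzh, hθdef, hXv, hZv, hXZv]
      rw [hPA', hPB', hσA, hσB, hσ4]
      rw [hP4] at hWP
      rw [hσ4] at hσ
      have key := tc_ineq (W q) (∏ i ∈ (A ∪ B)ᶜ, (1 + r q i)) (∏ i ∈ A \ B, (1 + r q i)) (∏ i ∈ B \ A, (1 + r q i))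
        (∏ i ∈ A ∩ B, (1 + r q i)) (∑ i ∈ (A ∪ B)ᶜ, r q i) (∑ i ∈ A \ B, r q i) (∑ i ∈ B \ A, r q i) (∑ i ∈ A ∩ B, r q i)
        (sum_nonneg fun i _ => hr0 i) (sum_nonneg fun i _ => hr0 i) (sum_nonneg fun i _ => hr0 i) (sum_nonneg fun i _ => hr0 i)
        (one_add_sum_le hq _) (one_add_sum_le hq _) (one_add_sum_le hq _) (one_add_sum_le hq _) hσ hWP
      ring_nf at key ⊢
      linarith [key]
    · -- one of the families is empty: both sides vanish
      have h0 : 𝒳 ∩ 𝒵 = ∅ := by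
        rw [not_and_or, Set.not_nonempty_iff_eq_empty, Set.not_nonempty_iff_eq_empty] at hne
        rcases hne with h | h
        · rw [h, Set.empty_inter]
        · rw [h, Set.inter_empty]
      have hL : ∑ T, rho q T * ind (𝒳 ∩ 𝒵) T = 0 := sum_eq_zero fun T _ => by rw [h0, ind_of_not_mem (Set.notMem_empty T), mul_zero]
      rw [hL, mul_zero, tcRHS, h0, Set.inter_empty, SahiTransportCert.pr_empty]
      rw [not_and_or, Set.not_nonempty_iff_eq_empty, Set.not_nonempty_iff_eq_empty] at hne
      rcases hne with h | h
      · rw [h, SahiTransportCert.pr_empty, Set.inter_empty, SahiTransportCert.pr_empty]; ring_nf; rfl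
      · rw [h, SahiTransportCert.pr_empty, Set.inter_empty, SahiTransportCert.pr_empty]; ring_nf; rfl

end Cert

/-! ### Kahn's Conjecture 5 / Sahi's `C₃` for the all-but-one first slot -/

/-- **KAHN'S CONJECTURE 5 / SAHI'S `C₃` WHEN THE FIRST SLOT IS "ALL BUT AT MOST ONE COORDINATE OF THE BLOCK OPEN".**  For a block
`e : Fin k ↪ ι` (`k ≥ 1`) with interior parameters, an increasing event `H` determined by the block whose pattern event is `allButOne k`,
and ALL increasing `U, V ⊆ 2^ι`: `E₃(1_H, 1_U, 1_V) ≥ 0`. [this work] -/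
theorem sahiE_three_nonneg_of_allButOne {ι : Type} [Fintype ι] (p : ι → unitInterval) (e : Fin k ↪ ι) (hk : 0 < k)
    (hp : ∀ i, 0 < (p (e i) : ℝ) ∧ (p (e i) : ℝ) < 1) {H : Set (Set ι)} (hH : DeterminedBy H (Set.range e))
    (hpat : pat e H = allButOne k) {U V : Set (Set ι)} (hU : IsUpperSet U) (hV : IsUpperSet V) :
    0 ≤ sahiE (bernoulliWeight p) 3 ![ind H, ind U, ind V] := by
  have hq : ∀ i, 0 < (pk e p i : ℝ) ∧ (pk e p i : ℝ) < 1 := hp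
  have hc : RhoCert (pk e p) (pat e H) (rho (pk e p)) := by rw [hpat]; exact rhoCert_allButOne hq hk
  exact sahiE_three_nonneg_of_rhoCert p e hH hc hU hV

end SahiAllButOne

end Summit.CriticalPhenomena.PercolationContinuityZ3.Theorems
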